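import Mathlib

/-!
# PneNP / OverlapGapAlgebra — crux `SolvableImpliesStableSection` (stmt-PneNP-2463):
# the MONOTONE REPAIR block (3/·) — tree codes: assembling a root and its subtrees

Support for crux `stmt-PneNP-2463` (`Summit.PneNP.PneNP.Theses.OverlapGapAlgebra.SolvableImpliesStableSection`):
the f-free block "bounded-round monotone repair gives stable sections up to `α ≤ 2^k/(4k)`".
Witness trees are coded as finite sets of labelled addresses
`(a, (x, r)) : List (Fin k) × (Fin m × ℕ)` — the address `a` is the list of slots on the path from the
node UP to the root (the root is `[]`, the child hanging at slot `j` of the node at `a` sits at `j :: a`),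
`x` is the clause of the node and `r` its round.  A tree with root label `(c, r)` and subtrees
`ch j` (optional, one per slot) is assembled by an opaque operation `asm` specified by membership only
(hypothesis `hasm`: the elements of `asm c r ch` are the root `([], (c, r))` and the shifted elements
`(b ++ [j], lab)` of the subtrees `(b, lab) ∈ ch j`).  This file derives from that specification:

* `sissR_asm_mem_nil`, `sissR_asm_mem_concat`, `sissR_asm_mem_single`, `sissR_asm_mem_cons_concat` —
  membership of the root address, of shifted addresses, of depth-one addresses, of children of
  shifted addresses;
* `sissR_asm_eq` — the assembled code as an explicit finite set (root inserted into the disjoint union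
  of the shifted subtrees);
* `sissR_wt_asm` — the WEIGHT `∏_e 2^{-k} · (1 if root else 1/n)` of an assembled code is
  `2^{-k} · ∏_j (1 | wt(ch j)/n)` when every subtree has exactly one root.
No definitions (all objects are hypotheses); axioms `propext`, `Classical.choice`, `Quot.sound`.
-/

set_option linter.dupNamespace false -- `Summit.PneNP.PneNP.…`: summit = sub-problem (D-0017)

namespace Summit.PneNP.PneNP.Theorems

open Finset
open scoped Classical

section TreeAsm

variable {m k n : ℕ}

/-- Appending one slot is injective in both arguments. -/
theorem sissR_concat_inj (b b' : List (Fin k)) (j j' : Fin k) (h : b ++ [j] = b' ++ [j']) :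
    b = b' ∧ j = j' := by
  have h2 := List.append_inj' h rfl
  exact ⟨h2.1, by simpa using h2.2⟩

/-- An address ending in a slot is not the root address. -/
theorem sissR_concat_ne_nil (b : List (Fin k)) (j : Fin k) : b ++ [j] ≠ [] := by
  simp

/-- **Root membership.** The root address of `asm c r ch` carries exactly the label `(c, r)`. -/
theorem sissR_asm_mem_nil (asm : Fin m → ℕ → (Fin k → Option (Finset (List (Fin k) × (Fin m × ℕ)))) → Finset (List (Fin k) × (Fin m × ℕ)))
    (hasm : ∀ (c : Fin m) (r : ℕ) (ch : Fin k → Option (Finset (List (Fin k) × (Fin m × ℕ))))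
      (e : List (Fin k) × (Fin m × ℕ)), e ∈ asm c r ch ↔ (e = ([], (c, r)) ∨
      ∃ (j : Fin k) (S : Finset (List (Fin k) × (Fin m × ℕ))), ch j = some S ∧
        ∃ b : List (Fin k), (b, e.2) ∈ S ∧ e.1 = b ++ [j]))
    (c : Fin m) (r : ℕ) (ch : Fin k → Option (Finset (List (Fin k) × (Fin m × ℕ)))) (lab : Fin m × ℕ) :
    (([] : List (Fin k)), lab) ∈ asm c r ch ↔ lab = (c, r) := by
  rw [hasm]
  constructor
  · rintro (h | ⟨j, S, _, b, _, hb⟩)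
    · exact (Prod.mk.inj h).2
    · exact absurd hb.symm (sissR_concat_ne_nil b j)
  · intro h
    left
    rw [h]

/-- **Shifted membership.** `(b ++ [j], lab) ∈ asm c r ch` iff the subtree at slot `j` exists and
contains `(b, lab)`. -/
theorem sissR_asm_mem_concat (asm : Fin m → ℕ → (Fin k → Option (Finset (List (Fin k) × (Fin m × ℕ)))) → Finset (List (Fin k) × (Fin m × ℕ)))
    (hasm : ∀ (c : Fin m) (r : ℕ) (ch : Fin k → Option (Finset (List (Fin k) × (Fin m × ℕ))))
      (e : List (Fin k) × (Fin m × ℕ)), e ∈ asm c r ch ↔ (e = ([], (c, r)) ∨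
      ∃ (j : Fin k) (S : Finset (List (Fin k) × (Fin m × ℕ))), ch j = some S ∧
        ∃ b : List (Fin k), (b, e.2) ∈ S ∧ e.1 = b ++ [j]))
    (c : Fin m) (r : ℕ) (ch : Fin k → Option (Finset (List (Fin k) × (Fin m × ℕ)))) (b : List (Fin k)) (j : Fin k)
    (lab : Fin m × ℕ) :
    (b ++ [j], lab) ∈ asm c r ch ↔ ∃ S : Finset (List (Fin k) × (Fin m × ℕ)), ch j = some S ∧ (b, lab) ∈ S := by
  rw [hasm]
  constructor
  · rintro (h | ⟨j', S, hS, b', hb', hbb⟩)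
    · exact absurd (Prod.mk.inj h).1 (sissR_concat_ne_nil b j)
    · obtain ⟨rfl, rfl⟩ := sissR_concat_inj b b' j j' hbb
      exact ⟨S, hS, hb'⟩
  · rintro ⟨S, hS, hb⟩
    exact Or.inr ⟨j, S, hS, b, hb, rfl⟩

/-- **Depth-one membership.** `([j], lab) ∈ asm c r ch` iff the subtree at slot `j` exists and has
root label `lab`. -/
theorem sissR_asm_mem_single (asm : Fin m → ℕ → (Fin k → Option (Finset (List (Fin k) × (Fin m × ℕ)))) → Finset (List (Fin k) × (Fin m × ℕ)))
    (hasm : ∀ (c : Fin m) (r : ℕ) (ch : Fin k → Option (Finset (List (Fin k) × (Fin m × ℕ))))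
      (e : List (Fin k) × (Fin m × ℕ)), e ∈ asm c r ch ↔ (e = ([], (c, r)) ∨
      ∃ (j : Fin k) (S : Finset (List (Fin k) × (Fin m × ℕ))), ch j = some S ∧
        ∃ b : List (Fin k), (b, e.2) ∈ S ∧ e.1 = b ++ [j]))
    (c : Fin m) (r : ℕ) (ch : Fin k → Option (Finset (List (Fin k) × (Fin m × ℕ)))) (j : Fin k) (lab : Fin m × ℕ) :
    ([j], lab) ∈ asm c r ch ↔ ∃ S : Finset (List (Fin k) × (Fin m × ℕ)), ch j = some S ∧ (([] : List (Fin k)), lab) ∈ S := by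
  rw [show ([j] : List (Fin k)) = [] ++ [j] from rfl]
  exact sissR_asm_mem_concat asm hasm c r ch [] j lab

/-- **Children of shifted addresses.** `(j' :: (b ++ [j]), lab) ∈ asm c r ch` iff the subtree at slot
`j` exists and contains `(j' :: b, lab)`. -/
theorem sissR_asm_mem_cons_concat (asm : Fin m → ℕ → (Fin k → Option (Finset (List (Fin k) × (Fin m × ℕ)))) → Finset (List (Fin k) × (Fin m × ℕ)))
    (hasm : ∀ (c : Fin m) (r : ℕ) (ch : Fin k → Option (Finset (List (Fin k) × (Fin m × ℕ))))
      (e : List (Fin k) × (Fin m × ℕ)), e ∈ asm c r ch ↔ (e = ([], (c, r)) ∨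
      ∃ (j : Fin k) (S : Finset (List (Fin k) × (Fin m × ℕ))), ch j = some S ∧
        ∃ b : List (Fin k), (b, e.2) ∈ S ∧ e.1 = b ++ [j]))
    (c : Fin m) (r : ℕ) (ch : Fin k → Option (Finset (List (Fin k) × (Fin m × ℕ)))) (b : List (Fin k)) (j j' : Fin k)
    (lab : Fin m × ℕ) :
    (j' :: (b ++ [j]), lab) ∈ asm c r ch ↔ ∃ S : Finset (List (Fin k) × (Fin m × ℕ)), ch j = some S ∧ (j' :: b, lab) ∈ S := by
  rw [← List.cons_append]
  exact sissR_asm_mem_concat asm hasm c r ch (j' :: b) j lab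

/-- **The assembled code as an explicit finite set**: the root inserted into the union over the slots
of the shifted subtrees. -/
theorem sissR_asm_eq (asm : Fin m → ℕ → (Fin k → Option (Finset (List (Fin k) × (Fin m × ℕ)))) → Finset (List (Fin k) × (Fin m × ℕ)))
    (hasm : ∀ (c : Fin m) (r : ℕ) (ch : Fin k → Option (Finset (List (Fin k) × (Fin m × ℕ))))
      (e : List (Fin k) × (Fin m × ℕ)), e ∈ asm c r ch ↔ (e = ([], (c, r)) ∨
      ∃ (j : Fin k) (S : Finset (List (Fin k) × (Fin m × ℕ))), ch j = some S ∧
        ∃ b : List (Fin k), (b, e.2) ∈ S ∧ e.1 = b ++ [j]))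
    (c : Fin m) (r : ℕ) (ch : Fin k → Option (Finset (List (Fin k) × (Fin m × ℕ)))) :
    asm c r ch = insert (([] : List (Fin k)), (c, r))
      ((univ : Finset (Fin k)).biUnion fun j => ((ch j).getD ∅).image fun e => (e.1 ++ [j], e.2)) := by
  ext e
  rw [hasm, Finset.mem_insert, Finset.mem_biUnion]
  refine or_congr Iff.rfl ⟨?_, ?_⟩
  · rintro ⟨j, S, hS, b, hb, he⟩
    refine ⟨j, mem_univ _, ?_⟩
    rw [Finset.mem_image]
    refine ⟨(b, e.2), ?_, ?_⟩
    · rw [hS]; exact hb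
    · ext1
      · exact he.symm
      · rfl
  · rintro ⟨j, _, hj⟩
    rw [Finset.mem_image] at hj
    obtain ⟨e', he', hee⟩ := hj
    cases hS : ch j with
    | none => rw [hS] at he'; simp at he'
    | some S =>
      rw [hS] at he'
      refine ⟨j, S, hS, e'.1, ?_, ?_⟩
      · rw [← hee]; exact he'
      · rw [← hee]

/-- **Weight of an assembled code.** If every subtree has exactly one root element, then
`wt(asm c r ch) = 2^{-k} · ∏_j f(ch j)` with `f(none) = 1` and `f(some S) = wt(S)/n`, where
`wt(T) = ∏_{e ∈ T} 2^{-k} · (1 if e is the root else 1/n)`. -/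
theorem sissR_wt_asm (asm : Fin m → ℕ → (Fin k → Option (Finset (List (Fin k) × (Fin m × ℕ)))) → Finset (List (Fin k) × (Fin m × ℕ)))
    (hasm : ∀ (c : Fin m) (r : ℕ) (ch : Fin k → Option (Finset (List (Fin k) × (Fin m × ℕ))))
      (e : List (Fin k) × (Fin m × ℕ)), e ∈ asm c r ch ↔ (e = ([], (c, r)) ∨
      ∃ (j : Fin k) (S : Finset (List (Fin k) × (Fin m × ℕ))), ch j = some S ∧
        ∃ b : List (Fin k), (b, e.2) ∈ S ∧ e.1 = b ++ [j]))
    (c : Fin m) (r : ℕ) (ch : Fin k → Option (Finset (List (Fin k) × (Fin m × ℕ))))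
    (hroot : ∀ (j : Fin k) (S : Finset (List (Fin k) × (Fin m × ℕ))), ch j = some S →
      (S.filter fun e => e.1 = []).card = 1) :
    (∏ e ∈ asm c r ch, ((1 / 2 : ℝ) ^ k * (if e.1 = [] then (1 : ℝ) else 1 / (n : ℝ))))
      = (1 / 2 : ℝ) ^ k * ∏ j : Fin k, (ch j).elim (1 : ℝ) (fun S => (∏ e ∈ S, ((1 / 2 : ℝ) ^ k * (if e.1 = [] then (1 : ℝ) else 1 / (n : ℝ)))) / n) := by
  rw [sissR_asm_eq asm hasm c r ch]
  -- the root is not a shifted element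
  have hroot_nmem : (([] : List (Fin k)), (c, r)) ∉
      (univ : Finset (Fin k)).biUnion (fun j => ((ch j).getD ∅).image fun e => (e.1 ++ [j], e.2)) := by
    rw [Finset.mem_biUnion]
    rintro ⟨j, _, hj⟩
    rw [Finset.mem_image] at hj
    obtain ⟨e', _, hee⟩ := hj
    exact sissR_concat_ne_nil e'.1 j (Prod.mk.inj hee).1
  rw [Finset.prod_insert hroot_nmem, if_pos rfl, mul_one]
  congr 1
  -- the shifted subtrees are pairwise disjoint
  have hdisj : Set.PairwiseDisjoint (↑(univ : Finset (Fin k)))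
      (fun j => ((ch j).getD ∅).image fun e : List (Fin k) × (Fin m × ℕ) => (e.1 ++ [j], e.2)) := by
    intro j _ j' _ hjj
    rw [Function.onFun, Finset.disjoint_left]
    intro e he he'
    rw [Finset.mem_image] at he he'
    obtain ⟨e₁, _, h₁⟩ := he
    obtain ⟨e₂, _, h₂⟩ := he'
    have h12 : e₁.1 ++ [j] = e₂.1 ++ [j'] := by
      rw [(Prod.mk.inj h₁).1, (Prod.mk.inj h₂).1]
    exact hjj (sissR_concat_inj e₁.1 e₂.1 j j' h12).2
  rw [Finset.prod_biUnion hdisj]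
  refine Finset.prod_congr rfl fun j _ => ?_
  cases hS : ch j with
  | none => simp
  | some S =>
    simp only [Option.getD_some, Option.elim_some]
    -- the shift is injective
    have hinj : Set.InjOn (fun e : List (Fin k) × (Fin m × ℕ) => (e.1 ++ [j], e.2)) ↑S := by
      intro e₁ _ e₂ _ h
      have h' := Prod.mk.inj h
      ext1
      · exact (sissR_concat_inj e₁.1 e₂.1 j j h'.1).1
      · exact h'.2
    rw [Finset.prod_image hinj]
    -- every shifted element is a non-root: factor `2^{-k}/n` each
    have h1 : ∏ e ∈ S, ((1 / 2 : ℝ) ^ k * (if e.1 ++ [j] = [] then (1 : ℝ) else 1 / (n : ℝ)))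
        = (∏ _e ∈ S, (1 / 2 : ℝ) ^ k) * (1 / (n : ℝ)) ^ S.card := by
      rw [← Finset.prod_const, ← Finset.prod_mul_distrib]
      refine Finset.prod_congr rfl fun e _ => ?_
      rw [if_neg (sissR_concat_ne_nil e.1 j)]
    -- the subtree has one root and `|S| - 1` non-roots
    have hnot : (S.filter fun e : List (Fin k) × (Fin m × ℕ) => ¬ (e.1 = [])).card = S.card - 1 := by
      have hsum := Finset.card_filter_add_card_filter_not (s := S) (fun e : List (Fin k) × (Fin m × ℕ) => e.1 = [])
      rw [hroot j S hS] at hsum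
      omega
    have h2 : (∏ e ∈ S, ((1 / 2 : ℝ) ^ k * (if e.1 = [] then (1 : ℝ) else 1 / (n : ℝ)))) = (∏ _e ∈ S, (1 / 2 : ℝ) ^ k) * (1 / (n : ℝ)) ^ (S.card - 1) := by
      rw [Finset.prod_mul_distrib]
      congr 1
      rw [← Finset.prod_filter_mul_prod_filter_not S (fun e : List (Fin k) × (Fin m × ℕ) => e.1 = []),
        Finset.prod_congr rfl (fun e he => if_pos (Finset.mem_filter.1 he).2), Finset.prod_const_one,
        one_mul, Finset.prod_congr rfl (fun e he => if_neg (Finset.mem_filter.1 he).2), Finset.prod_const,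
        hnot]
    have hcard : 1 ≤ S.card := by
      calc 1 = (S.filter fun e => e.1 = []).card := (hroot j S hS).symm
        _ ≤ S.card := Finset.card_filter_le _ _
    have h3 : (1 / (n : ℝ)) ^ S.card = (1 / (n : ℝ)) ^ (S.card - 1) / n := by
      rw [div_eq_mul_one_div ((1 / (n : ℝ)) ^ (S.card - 1)), ← pow_succ, Nat.sub_add_cancel hcard]
    rw [h1, h2, mul_div_assoc, h3]

end TreeAsm

end Summit.PneNP.PneNP.Theorems
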